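import Literature.Analysis.SpecialFunctions.SpheroidalHarmonicSeries
import HarnessLib

/-!
# Analytic solutions at a regular singular point with exponent `0`: the confluent-Heun-type
# equation `ξ(ξ+1)ρ'' + (α₂ξ² + α₁ξ + 1 + α₀)ρ' + (β₂ξ² + β₁ξ + β₀)ρ = 0`

Topic `Literature/Analysis/ODE` (namespace `Literature.Analysis.ODE`). The radial Klein–Gordon /
Teukolsky-type equations on Kerr, after factoring out the horizon phase, take near the event
horizon `ξ = 0` (with `ξ = (r − r₊)/(r₊ − r₋)`) the normal form
`ξ(ξ+1)ρ'' + (α₂ξ² + α₁ξ + 1 + α₀)ρ' + (β₂ξ² + β₁ξ + β₀)ρ = 0` with complex parameters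
`p = (α₀, …, β₂)`, a regular singular point with exponents `{0, −α₀}`; for `|α₀| < 1` the solution
analytic at `ξ = 0` with `ρ(0) = 1` is unique and is the "ingoing"/smooth-across-the-horizon
solution (Shlapentokh-Rothman, CMP 329 (2014), §2 (2.3) and Lemma 4.5; Hartman Ch. IV §12). This
file constructs it by the method of `RecursiveSeries.lean` / `SpheroidalHarmonicSeries.lean`:

* `heunCoeff α₀ α₁ α₂ β₀ β₁ β₂ k`: the power-series coefficients, by the three-term recursion
  `(k+1)(k+1+α₀) b_{k+1} = −(k(k−1) + α₁k + β₀) bₖ − (α₂(k−1) + β₁) b_{k−1} − β₂ b_{k−2}`, `b₀ = 1`;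
* the rescaled sequence `bₖ 2^{−k}/(k+1)^N` is the fixed point of an affine contraction
  `T(p) = α₀·D + Σⱼ (symbols affine in p)·Sʲ⁺¹` on `ℕ →ᵇ ℂ` (the divisor `k+1+α₀` is moved to the
  diagonal term `α₀·D`, keeping `T` AFFINE in `p`), with `‖T(p)‖ ≤ 7/8` for `‖p‖ ≤ R`,
  `‖α₀‖ ≤ 1/4`, `N ≥ 13R` (`norm_heunOp_le`);
* hence `‖bₖ‖ ≤ 8 (k+1)^N 2ᵏ` (`norm_heunCoeff_le`: radius of convergence `≥ 1/2`; the true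
  radius is `1`, the distance to the other singular point `ξ = −1`), and the coefficients depend
  holomorphically on `p` (`contDiffOn_heunFix`).

The series, its differential equation and the joint smoothness in `(ξ, p)` follow in the second
part of the file. Everything is proved; no new analytic facts are assumed.

## References

* P. Hartman, *Ordinary Differential Equations*, 2nd ed., SIAM Classics 38 (2002), Ch. IV §12.
  Key `Hartman2002`.
* Y. Shlapentokh-Rothman, Comm. Math. Phys. 329 (2014) 859–891, §2 (2.2)–(2.3), Lemma 4.5.
  Key `ShlapentokhRothman2014KleinGordon`.
-/

noncomputable section

open Set Filter Metric Complex
open scoped Topology BigOperators ComplexConjugate ContDiff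

namespace Literature.Analysis.ODE

open Literature.Analysis.SpecialFunctions

/-! ### The coefficients -/

/-- Three consecutive coefficients `(bₖ, bₖ₊₁, bₖ₊₂)` of the analytic solution (primitive
recursion). [cite: Hartman2002, Ch. IV §12 (12.12)] -/
def heunTriple (α₀ α₁ α₂ β₀ β₁ β₂ : ℂ) : ℕ → ℂ × ℂ × ℂ
  | 0 =>
    (1, -β₀ / (1 + α₀), (-(α₁ + β₀) * (-β₀ / (1 + α₀)) - β₁) / (2 * (2 + α₀)))
  | k + 1 =>
    ((heunTriple α₀ α₁ α₂ β₀ β₁ β₂ k).2.1, (heunTriple α₀ α₁ α₂ β₀ β₁ β₂ k).2.2,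
      (-(((k : ℂ) + 2) * ((k : ℂ) + 1) + α₁ * ((k : ℂ) + 2) + β₀) * (heunTriple α₀ α₁ α₂ β₀ β₁ β₂ k).2.2 -
          (α₂ * ((k : ℂ) + 1) + β₁) * (heunTriple α₀ α₁ α₂ β₀ β₁ β₂ k).2.1 -
          β₂ * (heunTriple α₀ α₁ α₂ β₀ β₁ β₂ k).1) /
        (((k : ℂ) + 3) * ((k : ℂ) + 3 + α₀)))

/-- **The coefficients `bₖ`** of the solution `Σ bₖ ξᵏ`, analytic at `ξ = 0` with `b₀ = 1`, of
`ξ(ξ+1)ρ'' + (α₂ξ² + α₁ξ + 1 + α₀)ρ' + (β₂ξ² + β₁ξ + β₀)ρ = 0`. [cite: Hartman2002, Ch. IV §12 (12.12)] -/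
def heunCoeff (α₀ α₁ α₂ β₀ β₁ β₂ : ℂ) (k : ℕ) : ℂ := (heunTriple α₀ α₁ α₂ β₀ β₁ β₂ k).1

section Coeff

variable (α₀ α₁ α₂ β₀ β₁ β₂ : ℂ)

/-- `b₀ = 1`. [folklore] -/
@[simp] theorem heunCoeff_zero : heunCoeff α₀ α₁ α₂ β₀ β₁ β₂ 0 = 1 := rfl

/-- `b₁ = −β₀/(1 + α₀)`. [folklore] -/
theorem heunCoeff_one : heunCoeff α₀ α₁ α₂ β₀ β₁ β₂ 1 = -β₀ / (1 + α₀) := rfl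

/-- `b₂`. [folklore] -/
theorem heunCoeff_two :
    heunCoeff α₀ α₁ α₂ β₀ β₁ β₂ 2 = (-(α₁ + β₀) * (-β₀ / (1 + α₀)) - β₁) / (2 * (2 + α₀)) := rfl

/-- The recursion for `b_{k+3}`. [folklore] -/
theorem heunCoeff_add_three (k : ℕ) :
    heunCoeff α₀ α₁ α₂ β₀ β₁ β₂ (k + 3) =
      (-(((k : ℂ) + 2) * ((k : ℂ) + 1) + α₁ * ((k : ℂ) + 2) + β₀) * heunCoeff α₀ α₁ α₂ β₀ β₁ β₂ (k + 2) -
          (α₂ * ((k : ℂ) + 1) + β₁) * heunCoeff α₀ α₁ α₂ β₀ β₁ β₂ (k + 1) -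
          β₂ * heunCoeff α₀ α₁ α₂ β₀ β₁ β₂ k) /
        (((k : ℂ) + 3) * ((k : ℂ) + 3 + α₀)) := rfl

/-- Non-vanishing of the divisors `k + 1 + α₀` for `‖α₀‖ < 1`. [folklore] -/
theorem natCast_add_one_add_ne_zero (hα : ‖α₀‖ < 1) (k : ℕ) : (k : ℂ) + 1 + α₀ ≠ 0 := by
  intro h
  have h1 : α₀ = -((k : ℂ) + 1) := by linear_combination h
  have h2 : ‖α₀‖ = (k : ℝ) + 1 := by
    rw [h1, norm_neg]
    have : ((k : ℂ) + 1) = (((k : ℝ) + 1 : ℝ) : ℂ) := by push_cast; ring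
    rw [this, Complex.norm_real, Real.norm_eq_abs, abs_of_nonneg (by positivity)]
  have hk : (0 : ℝ) ≤ k := k.cast_nonneg
  linarith

variable {α₀}

/-- The recursion in cleared form at `k = 0`: `1·(1 + α₀) b₁ = −β₀ b₀`. [folklore] -/
theorem heunCoeff_rec_zero (hα : ‖α₀‖ < 1) :
    (1 : ℂ) * ((0 : ℂ) + 1 + α₀) * heunCoeff α₀ α₁ α₂ β₀ β₁ β₂ 1 =
      -((0 : ℂ) * (0 - 1) + α₁ * 0 + β₀) * heunCoeff α₀ α₁ α₂ β₀ β₁ β₂ 0 := by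
  rw [heunCoeff_one, heunCoeff_zero]
  have h := natCast_add_one_add_ne_zero α₀ hα 0
  push_cast at h
  rw [zero_add] at h ⊢
  field_simp
  ring

/-- The recursion in cleared form at `k = 1`: `2(2 + α₀) b₂ = −(α₁ + β₀) b₁ − β₁ b₀`. [folklore] -/
theorem heunCoeff_rec_one (hα : ‖α₀‖ < 1) :
    (2 : ℂ) * ((1 : ℂ) + 1 + α₀) * heunCoeff α₀ α₁ α₂ β₀ β₁ β₂ 2 =
      -((1 : ℂ) * (1 - 1) + α₁ * 1 + β₀) * heunCoeff α₀ α₁ α₂ β₀ β₁ β₂ 1 -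
        (α₂ * (1 - 1) + β₁) * heunCoeff α₀ α₁ α₂ β₀ β₁ β₂ 0 := by
  rw [heunCoeff_two, heunCoeff_one, heunCoeff_zero]
  have h1 := natCast_add_one_add_ne_zero α₀ hα 0
  have h2 := natCast_add_one_add_ne_zero α₀ hα 1
  push_cast at h1 h2
  rw [zero_add] at h1
  rw [show (1 : ℂ) + 1 + α₀ = 2 + α₀ by ring] at h2 ⊢
  field_simp
  ring

/-- The recursion in cleared form at `k + 2`:
`(k+3)(k+3+α₀) b_{k+3} = −((k+2)(k+1) + α₁(k+2) + β₀) b_{k+2} − (α₂(k+1) + β₁) b_{k+1} − β₂ bₖ`. [folklore] -/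
theorem heunCoeff_rec_add_two (hα : ‖α₀‖ < 1) (k : ℕ) :
    ((k : ℂ) + 3) * (((k : ℂ) + 2) + 1 + α₀) * heunCoeff α₀ α₁ α₂ β₀ β₁ β₂ (k + 3) =
      -(((k : ℂ) + 2) * ((k : ℂ) + 2 - 1) + α₁ * ((k : ℂ) + 2) + β₀) * heunCoeff α₀ α₁ α₂ β₀ β₁ β₂ (k + 2) -
        (α₂ * ((k : ℂ) + 2 - 1) + β₁) * heunCoeff α₀ α₁ α₂ β₀ β₁ β₂ (k + 1) -
        β₂ * heunCoeff α₀ α₁ α₂ β₀ β₁ β₂ k := by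
  rw [heunCoeff_add_three]
  have h1 : (k : ℂ) + 3 ≠ 0 := by
    have : (0 : ℝ) < (k : ℝ) + 3 := by positivity
    exact_mod_cast this.ne'
  have h2 := natCast_add_one_add_ne_zero α₀ hα (k + 2)
  push_cast at h2
  rw [show (k : ℂ) + 2 + 1 + α₀ = (k : ℂ) + 3 + α₀ by ring] at h2 ⊢
  field_simp
  ring

end Coeff

/-! ### Holomorphic dependence on the parameters -/

/-- The parameter space `ℂ⁶ = {(α₀, α₁, α₂, β₀, β₁, β₂)}` with the sup norm. [folklore] -/
abbrev HP : Type := Fin 6 → ℂ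

/-- The coefficients as functions of the parameter vector. [folklore] -/
def heunCoeffP (p : HP) (k : ℕ) : ℂ := heunCoeff (p 0) (p 1) (p 2) (p 3) (p 4) (p 5) k

/-- The admissible parameters for the recursion: `‖α₀‖ < 1`. [folklore] -/
theorem isOpen_hpDom : IsOpen {p : HP | ‖p 0‖ < 1} :=
  isOpen_lt (continuous_apply 0).norm continuous_const

/-- The coefficients depend holomorphically on `p` where `‖α₀‖ < 1`. [folklore] -/
theorem contDiffOn_heunTriple (k : ℕ) {n : WithTop ℕ∞} :
    ContDiffOn ℂ n (fun p : HP ↦ heunTriple (p 0) (p 1) (p 2) (p 3) (p 4) (p 5) k) {p : HP | ‖p 0‖ < 1} := by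
  have hc : ∀ i : Fin 6, ContDiff ℂ n fun p : HP ↦ p i := fun i ↦ contDiff_apply ℂ ℂ i
  induction k with
  | zero =>
    intro p hp
    have h1 : (1 : ℂ) + p 0 ≠ 0 := by
      have := natCast_add_one_add_ne_zero (p 0) hp 0
      push_cast at this; rwa [zero_add] at this
    have h2 : (2 : ℂ) * (2 + p 0) ≠ 0 := by
      have := natCast_add_one_add_ne_zero (p 0) hp 1
      push_cast at this
      rw [show (1 : ℂ) + 1 + p 0 = 2 + p 0 by ring] at this
      exact mul_ne_zero two_ne_zero this
    have e1 : ContDiffAt ℂ n (fun p : HP ↦ (1 : ℂ) + p 0) p := (contDiffAt_const.add (hc 0).contDiffAt)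
    have e2 : ContDiffAt ℂ n (fun p : HP ↦ (2 : ℂ) * (2 + p 0)) p :=
      contDiffAt_const.mul (contDiffAt_const.add (hc 0).contDiffAt)
    have hb1 : ContDiffAt ℂ n (fun p : HP ↦ -p 3 / (1 + p 0)) p := ((hc 3).contDiffAt.neg).div e1 h1
    have hb2 : ContDiffAt ℂ n (fun p : HP ↦ (-(p 1 + p 3) * (-p 3 / (1 + p 0)) - p 4) / (2 * (2 + p 0))) p :=
      (((((hc 1).add (hc 3)).contDiffAt.neg).mul hb1).sub (hc 4).contDiffAt).div e2 h2
    simp only [heunTriple]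
    exact (contDiffAt_const.prodMk (hb1.prodMk hb2)).contDiffWithinAt
  | succ k ih =>
    intro p hp
    have hU : {p : HP | ‖p 0‖ < 1} ∈ 𝓝 p := isOpen_hpDom.mem_nhds hp
    have ihAt : ContDiffAt ℂ n (fun p : HP ↦ heunTriple (p 0) (p 1) (p 2) (p 3) (p 4) (p 5) k) p :=
      (ih p hp).contDiffAt hU
    have h1 : ContDiffAt ℂ n (fun p : HP ↦ (heunTriple (p 0) (p 1) (p 2) (p 3) (p 4) (p 5) k).1) p :=
      contDiffAt_fst.comp p ihAt
    have h2 : ContDiffAt ℂ n (fun p : HP ↦ (heunTriple (p 0) (p 1) (p 2) (p 3) (p 4) (p 5) k).2.1) p :=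
      contDiffAt_fst.comp p (contDiffAt_snd.comp p ihAt)
    have h3 : ContDiffAt ℂ n (fun p : HP ↦ (heunTriple (p 0) (p 1) (p 2) (p 3) (p 4) (p 5) k).2.2) p :=
      contDiffAt_snd.comp p (contDiffAt_snd.comp p ihAt)
    have hd : ((k : ℂ) + 3) * ((k : ℂ) + 3 + p 0) ≠ 0 := by
      refine mul_ne_zero ?_ ?_
      · have : (0 : ℝ) < (k : ℝ) + 3 := by positivity
        exact_mod_cast this.ne'
      · have := natCast_add_one_add_ne_zero (p 0) hp (k + 2)
        push_cast at this
        rwa [show (k : ℂ) + 2 + 1 + p 0 = (k : ℂ) + 3 + p 0 by ring] at this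
    have ed : ContDiffAt ℂ n (fun p : HP ↦ ((k : ℂ) + 3) * ((k : ℂ) + 3 + p 0)) p :=
      contDiffAt_const.mul (contDiffAt_const.add (hc 0).contDiffAt)
    have hnum : ContDiffAt ℂ n (fun p : HP ↦
        (-(((k : ℂ) + 2) * ((k : ℂ) + 1) + p 1 * ((k : ℂ) + 2) + p 3) *
            (heunTriple (p 0) (p 1) (p 2) (p 3) (p 4) (p 5) k).2.2 -
          (p 2 * ((k : ℂ) + 1) + p 4) * (heunTriple (p 0) (p 1) (p 2) (p 3) (p 4) (p 5) k).2.1 -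
          p 5 * (heunTriple (p 0) (p 1) (p 2) (p 3) (p 4) (p 5) k).1)) p := by
      have q1 : ContDiffAt ℂ n (fun p : HP ↦ -(((k : ℂ) + 2) * ((k : ℂ) + 1) + p 1 * ((k : ℂ) + 2) + p 3)) p :=
        ((contDiffAt_const.add (((hc 1).contDiffAt).mul contDiffAt_const)).add (hc 3).contDiffAt).neg
      have q2 : ContDiffAt ℂ n (fun p : HP ↦ p 2 * ((k : ℂ) + 1) + p 4) p :=
        (((hc 2).contDiffAt).mul contDiffAt_const).add (hc 4).contDiffAt
      exact ((q1.mul h3).sub (q2.mul h2)).sub ((hc 5).contDiffAt.mul h1)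
    simp only [heunTriple]
    exact (h2.prodMk (h3.prodMk (hnum.div ed hd))).contDiffWithinAt

/-- `p ↦ bₖ(p)` is holomorphic on `‖α₀‖ < 1`. [folklore] -/
theorem contDiffOn_heunCoeffP (k : ℕ) {n : WithTop ℕ∞} :
    ContDiffOn ℂ n (fun p : HP ↦ heunCoeffP p k) {p : HP | ‖p 0‖ < 1} :=
  contDiff_fst.comp_contDiffOn (contDiffOn_heunTriple k)

/-! ### The rescaled sequence as the fixed point of an affine contraction -/

section Engine

/-- Symbol of the diagonal term (times `α₀`), output index `i`: `−1/i`. [folklore] -/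
def hsymD : ℕ → ℝ
  | 0 => 0
  | k + 1 => -(1 / ((k : ℝ) + 1))

/-- One-step symbol, constant part: `−(1/2)(Wₖ/Wₖ₊₁) k(k−1)/(k+1)²` at output index `k+1`. [folklore] -/
def hsymA (N : ℕ) : ℕ → ℝ
  | 0 => 0
  | k + 1 => -(1 / 2 * (sphW N k / sphW N (k + 1)) * ((k : ℝ) * ((k : ℝ) - 1) / ((k : ℝ) + 1) ^ 2))

/-- One-step symbol, `α₁` part: `−(1/2)(Wₖ/Wₖ₊₁) k/(k+1)²`. [folklore] -/
def hsymB (N : ℕ) : ℕ → ℝ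
  | 0 => 0
  | k + 1 => -(1 / 2 * (sphW N k / sphW N (k + 1)) * ((k : ℝ) / ((k : ℝ) + 1) ^ 2))

/-- One-step symbol, `β₀` part: `−(1/2)(Wₖ/Wₖ₊₁)/(k+1)²`. [folklore] -/
def hsymC (N : ℕ) : ℕ → ℝ
  | 0 => 0
  | k + 1 => -(1 / 2 * (sphW N k / sphW N (k + 1)) * (1 / ((k : ℝ) + 1) ^ 2))

/-- Two-step symbol, `α₂` part: `−(1/4)(Wₖ/Wₖ₊₂) k/(k+2)²` at output index `k+2`. [folklore] -/
def hsymE (N : ℕ) : ℕ → ℝ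
  | 0 => 0
  | 1 => 0
  | k + 2 => -(1 / 4 * (sphW N k / sphW N (k + 2)) * ((k : ℝ) / ((k : ℝ) + 2) ^ 2))

/-- Two-step symbol, `β₁` part: `−(1/4)(Wₖ/Wₖ₊₂)/(k+2)²`. [folklore] -/
def hsymF (N : ℕ) : ℕ → ℝ
  | 0 => 0
  | 1 => 0
  | k + 2 => -(1 / 4 * (sphW N k / sphW N (k + 2)) * (1 / ((k : ℝ) + 2) ^ 2))

/-- Three-step symbol, `β₂` part: `−(1/8)(Wₖ/Wₖ₊₃)/(k+3)²` at output index `k+3`. [folklore] -/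
def hsymG (N : ℕ) : ℕ → ℝ
  | 0 => 0
  | 1 => 0
  | 2 => 0
  | k + 3 => -(1 / 8 * (sphW N k / sphW N (k + 3)) * (1 / ((k : ℝ) + 3) ^ 2))

/-- `|D(i)| ≤ 1`. [folklore] -/
theorem abs_hsymD_le (i : ℕ) : |hsymD i| ≤ 1 := by
  cases i with
  | zero => norm_num [hsymD]
  | succ k =>
    simp only [hsymD, abs_neg]
    rw [abs_of_nonneg (by positivity), div_le_one (by positivity)]
    linarith [k.cast_nonneg (α := ℝ)]

/-- `|A(i)| ≤ 1/2`. [folklore] -/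
theorem abs_hsymA_le (N i : ℕ) : |hsymA N i| ≤ 1 / 2 := by
  cases i with
  | zero => norm_num [hsymA]
  | succ k =>
    simp only [hsymA, abs_neg]
    have hr0 : 0 ≤ sphW N k / sphW N (k + 1) := (div_pos (sphW_pos N k) (sphW_pos N (k + 1))).le
    have hr1 : sphW N k / sphW N (k + 1) ≤ 1 := sphW_div_le_one (Nat.le_succ k)
    have hk : (0 : ℝ) ≤ k := k.cast_nonneg
    rcases Nat.eq_zero_or_pos k with h0 | hpos
    · subst h0; norm_num
    · have hk1 : (1 : ℝ) ≤ k := by exact_mod_cast hpos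
      have hq0 : 0 ≤ (k : ℝ) * ((k : ℝ) - 1) / ((k : ℝ) + 1) ^ 2 := by
        apply div_nonneg (mul_nonneg hk (by linarith)) (by positivity)
      have hq1 : (k : ℝ) * ((k : ℝ) - 1) / ((k : ℝ) + 1) ^ 2 ≤ 1 := by
        rw [div_le_one (by positivity)]; nlinarith
      rw [abs_of_nonneg (by positivity)]
      calc 1 / 2 * (sphW N k / sphW N (k + 1)) * ((k : ℝ) * ((k : ℝ) - 1) / ((k : ℝ) + 1) ^ 2)
          ≤ 1 / 2 * 1 * 1 := by gcongr
        _ = 1 / 2 := by norm_num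

/-- `|B(i)| ≤ 1/(2(N+1))`. [folklore] -/
theorem abs_hsymB_le (N i : ℕ) : |hsymB N i| ≤ 1 / (2 * ((N : ℝ) + 1)) := by
  cases i with
  | zero => simp only [hsymB, abs_zero]; positivity
  | succ k =>
    simp only [hsymB, abs_neg]
    have hr0 : 0 ≤ sphW N k / sphW N (k + 1) := (div_pos (sphW_pos N k) (sphW_pos N (k + 1))).le
    have hrN : sphW N k / sphW N (k + 1) ≤ ((k : ℝ) + 1) / ((k : ℝ) + 1 + N) := sphW_div_le (Nat.lt_succ_self k)
    have hk : (0 : ℝ) ≤ k := k.cast_nonneg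
    have hN : (0 : ℝ) ≤ N := N.cast_nonneg
    rw [abs_of_nonneg (by positivity)]
    have e1 : (k : ℝ) / ((k : ℝ) + 1) ^ 2 ≤ 1 / ((k : ℝ) + 1) := by
      rw [div_le_div_iff₀ (by positivity) (by positivity)]; nlinarith
    have e2 : ((k : ℝ) + 1) / ((k : ℝ) + 1 + N) * (1 / ((k : ℝ) + 1)) = 1 / ((k : ℝ) + 1 + N) := by
      field_simp
    have e3 : 1 / ((k : ℝ) + 1 + N) ≤ 1 / ((N : ℝ) + 1) := one_div_le_one_div_of_le (by positivity) (by linarith)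
    calc 1 / 2 * (sphW N k / sphW N (k + 1)) * ((k : ℝ) / ((k : ℝ) + 1) ^ 2)
        ≤ 1 / 2 * (((k : ℝ) + 1) / ((k : ℝ) + 1 + N)) * (1 / ((k : ℝ) + 1)) := by gcongr
      _ = 1 / 2 * (1 / ((k : ℝ) + 1 + N)) := by rw [mul_assoc, e2]
      _ ≤ 1 / 2 * (1 / ((N : ℝ) + 1)) := by gcongr
      _ = 1 / (2 * ((N : ℝ) + 1)) := by rw [one_div_mul_one_div]

/-- `|C(i)| ≤ 1/(2(N+1))`. [folklore] -/
theorem abs_hsymC_le (N i : ℕ) : |hsymC N i| ≤ 1 / (2 * ((N : ℝ) + 1)) := by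
  cases i with
  | zero => simp only [hsymC, abs_zero]; positivity
  | succ k =>
    simp only [hsymC, abs_neg]
    have hr0 : 0 ≤ sphW N k / sphW N (k + 1) := (div_pos (sphW_pos N k) (sphW_pos N (k + 1))).le
    have hrN : sphW N k / sphW N (k + 1) ≤ ((k : ℝ) + 1) / ((k : ℝ) + 1 + N) := sphW_div_le (Nat.lt_succ_self k)
    have hk : (0 : ℝ) ≤ k := k.cast_nonneg
    have hN : (0 : ℝ) ≤ N := N.cast_nonneg
    rw [abs_of_nonneg (by positivity)]
    have e1 : 1 / ((k : ℝ) + 1) ^ 2 ≤ 1 / ((k : ℝ) + 1) := by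
      rw [div_le_div_iff₀ (by positivity) (by positivity)]; nlinarith
    have e2 : ((k : ℝ) + 1) / ((k : ℝ) + 1 + N) * (1 / ((k : ℝ) + 1)) = 1 / ((k : ℝ) + 1 + N) := by
      field_simp
    have e3 : 1 / ((k : ℝ) + 1 + N) ≤ 1 / ((N : ℝ) + 1) := one_div_le_one_div_of_le (by positivity) (by linarith)
    calc 1 / 2 * (sphW N k / sphW N (k + 1)) * (1 / ((k : ℝ) + 1) ^ 2)
        ≤ 1 / 2 * (((k : ℝ) + 1) / ((k : ℝ) + 1 + N)) * (1 / ((k : ℝ) + 1)) := by gcongr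
      _ = 1 / 2 * (1 / ((k : ℝ) + 1 + N)) := by rw [mul_assoc, e2]
      _ ≤ 1 / 2 * (1 / ((N : ℝ) + 1)) := by gcongr
      _ = 1 / (2 * ((N : ℝ) + 1)) := by rw [one_div_mul_one_div]

/-- `|E(i)| ≤ 1/(4(N+1))`. [folklore] -/
theorem abs_hsymE_le (N i : ℕ) : |hsymE N i| ≤ 1 / (4 * ((N : ℝ) + 1)) := by
  match i with
  | 0 => simp only [hsymE, abs_zero]; positivity
  | 1 => simp only [hsymE, abs_zero]; positivity
  | k + 2 =>
    simp only [hsymE, abs_neg]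
    have hr0 : 0 ≤ sphW N k / sphW N (k + 2) := (div_pos (sphW_pos N k) (sphW_pos N (k + 2))).le
    have hrN : sphW N k / sphW N (k + 2) ≤ ((k : ℝ) + 1) / ((k : ℝ) + 1 + N) := sphW_div_le (by omega)
    have hk : (0 : ℝ) ≤ k := k.cast_nonneg
    have hN : (0 : ℝ) ≤ N := N.cast_nonneg
    rw [abs_of_nonneg (by positivity)]
    have e1 : (k : ℝ) / ((k : ℝ) + 2) ^ 2 ≤ 1 / ((k : ℝ) + 1) := by
      rw [div_le_div_iff₀ (by positivity) (by positivity)]; nlinarith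
    have e2 : ((k : ℝ) + 1) / ((k : ℝ) + 1 + N) * (1 / ((k : ℝ) + 1)) = 1 / ((k : ℝ) + 1 + N) := by
      field_simp
    have e3 : 1 / ((k : ℝ) + 1 + N) ≤ 1 / ((N : ℝ) + 1) := one_div_le_one_div_of_le (by positivity) (by linarith)
    calc 1 / 4 * (sphW N k / sphW N (k + 2)) * ((k : ℝ) / ((k : ℝ) + 2) ^ 2)
        ≤ 1 / 4 * (((k : ℝ) + 1) / ((k : ℝ) + 1 + N)) * (1 / ((k : ℝ) + 1)) := by gcongr
      _ = 1 / 4 * (1 / ((k : ℝ) + 1 + N)) := by rw [mul_assoc, e2]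
      _ ≤ 1 / 4 * (1 / ((N : ℝ) + 1)) := by gcongr
      _ = 1 / (4 * ((N : ℝ) + 1)) := by rw [one_div_mul_one_div]

/-- `|F(i)| ≤ 1/(4(N+1))`. [folklore] -/
theorem abs_hsymF_le (N i : ℕ) : |hsymF N i| ≤ 1 / (4 * ((N : ℝ) + 1)) := by
  match i with
  | 0 => simp only [hsymF, abs_zero]; positivity
  | 1 => simp only [hsymF, abs_zero]; positivity
  | k + 2 =>
    simp only [hsymF, abs_neg]
    have hr0 : 0 ≤ sphW N k / sphW N (k + 2) := (div_pos (sphW_pos N k) (sphW_pos N (k + 2))).le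
    have hrN : sphW N k / sphW N (k + 2) ≤ ((k : ℝ) + 1) / ((k : ℝ) + 1 + N) := sphW_div_le (by omega)
    have hk : (0 : ℝ) ≤ k := k.cast_nonneg
    have hN : (0 : ℝ) ≤ N := N.cast_nonneg
    rw [abs_of_nonneg (by positivity)]
    have e1 : 1 / ((k : ℝ) + 2) ^ 2 ≤ 1 / ((k : ℝ) + 1) := by
      rw [div_le_div_iff₀ (by positivity) (by positivity)]; nlinarith
    have e2 : ((k : ℝ) + 1) / ((k : ℝ) + 1 + N) * (1 / ((k : ℝ) + 1)) = 1 / ((k : ℝ) + 1 + N) := by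
      field_simp
    have e3 : 1 / ((k : ℝ) + 1 + N) ≤ 1 / ((N : ℝ) + 1) := one_div_le_one_div_of_le (by positivity) (by linarith)
    calc 1 / 4 * (sphW N k / sphW N (k + 2)) * (1 / ((k : ℝ) + 2) ^ 2)
        ≤ 1 / 4 * (((k : ℝ) + 1) / ((k : ℝ) + 1 + N)) * (1 / ((k : ℝ) + 1)) := by gcongr
      _ = 1 / 4 * (1 / ((k : ℝ) + 1 + N)) := by rw [mul_assoc, e2]
      _ ≤ 1 / 4 * (1 / ((N : ℝ) + 1)) := by gcongr
      _ = 1 / (4 * ((N : ℝ) + 1)) := by rw [one_div_mul_one_div]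

/-- `|G(i)| ≤ 1/(8(N+1))`. [folklore] -/
theorem abs_hsymG_le (N i : ℕ) : |hsymG N i| ≤ 1 / (8 * ((N : ℝ) + 1)) := by
  match i with
  | 0 => simp only [hsymG, abs_zero]; positivity
  | 1 => simp only [hsymG, abs_zero]; positivity
  | 2 => simp only [hsymG, abs_zero]; positivity
  | k + 3 =>
    simp only [hsymG, abs_neg]
    have hr0 : 0 ≤ sphW N k / sphW N (k + 3) := (div_pos (sphW_pos N k) (sphW_pos N (k + 3))).le
    have hrN : sphW N k / sphW N (k + 3) ≤ ((k : ℝ) + 1) / ((k : ℝ) + 1 + N) := sphW_div_le (by omega)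
    have hk : (0 : ℝ) ≤ k := k.cast_nonneg
    have hN : (0 : ℝ) ≤ N := N.cast_nonneg
    rw [abs_of_nonneg (by positivity)]
    have e1 : 1 / ((k : ℝ) + 3) ^ 2 ≤ 1 / ((k : ℝ) + 1) := by
      rw [div_le_div_iff₀ (by positivity) (by positivity)]; nlinarith
    have e2 : ((k : ℝ) + 1) / ((k : ℝ) + 1 + N) * (1 / ((k : ℝ) + 1)) = 1 / ((k : ℝ) + 1 + N) := by
      field_simp
    have e3 : 1 / ((k : ℝ) + 1 + N) ≤ 1 / ((N : ℝ) + 1) := one_div_le_one_div_of_le (by positivity) (by linarith)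
    calc 1 / 8 * (sphW N k / sphW N (k + 3)) * (1 / ((k : ℝ) + 3) ^ 2)
        ≤ 1 / 8 * (((k : ℝ) + 1) / ((k : ℝ) + 1 + N)) * (1 / ((k : ℝ) + 1)) := by gcongr
      _ = 1 / 8 * (1 / ((k : ℝ) + 1 + N)) := by rw [mul_assoc, e2]
      _ ≤ 1 / 8 * (1 / ((N : ℝ) + 1)) := by gcongr
      _ = 1 / (8 * ((N : ℝ) + 1)) := by rw [one_div_mul_one_div]

/-- The symbols as elements of `ℕ →ᵇ ℂ`. [folklore] -/
def hcsD : CSeq := CSeq.mk (fun i ↦ (hsymD i : ℂ)) 1 fun i ↦ by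
  rw [Complex.norm_real, Real.norm_eq_abs]; exact abs_hsymD_le i

/-- See `hcsD`. [folklore] -/
def hcsA (N : ℕ) : CSeq := CSeq.mk (fun i ↦ (hsymA N i : ℂ)) (1 / 2) fun i ↦ by
  rw [Complex.norm_real, Real.norm_eq_abs]; exact abs_hsymA_le N i

/-- See `hcsD`. [folklore] -/
def hcsB (N : ℕ) : CSeq := CSeq.mk (fun i ↦ (hsymB N i : ℂ)) (1 / (2 * ((N : ℝ) + 1))) fun i ↦ by
  rw [Complex.norm_real, Real.norm_eq_abs]; exact abs_hsymB_le N i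

/-- See `hcsD`. [folklore] -/
def hcsC (N : ℕ) : CSeq := CSeq.mk (fun i ↦ (hsymC N i : ℂ)) (1 / (2 * ((N : ℝ) + 1))) fun i ↦ by
  rw [Complex.norm_real, Real.norm_eq_abs]; exact abs_hsymC_le N i

/-- See `hcsD`. [folklore] -/
def hcsE (N : ℕ) : CSeq := CSeq.mk (fun i ↦ (hsymE N i : ℂ)) (1 / (4 * ((N : ℝ) + 1))) fun i ↦ by
  rw [Complex.norm_real, Real.norm_eq_abs]; exact abs_hsymE_le N i

/-- See `hcsD`. [folklore] -/
def hcsF (N : ℕ) : CSeq := CSeq.mk (fun i ↦ (hsymF N i : ℂ)) (1 / (4 * ((N : ℝ) + 1))) fun i ↦ by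
  rw [Complex.norm_real, Real.norm_eq_abs]; exact abs_hsymF_le N i

/-- See `hcsD`. [folklore] -/
def hcsG (N : ℕ) : CSeq := CSeq.mk (fun i ↦ (hsymG N i : ℂ)) (1 / (8 * ((N : ℝ) + 1))) fun i ↦ by
  rw [Complex.norm_real, Real.norm_eq_abs]; exact abs_hsymG_le N i

/-- The three shift symbols, affine in `p`: `d₀ = A + α₁B + β₀C`, `d₁ = α₂E + β₁F`, `d₂ = β₂G`. [folklore] -/
def heunSym (N : ℕ) (p : HP) : Fin 3 → CSeq :=
  ![hcsA N + p 1 • hcsB N + p 3 • hcsC N, p 2 • hcsE N + p 4 • hcsF N, p 5 • hcsG N]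

/-- **The recursion operator** `T(p) = α₀·D + Σⱼ dⱼ(p) Sʲ⁺¹` (the divisor `k+1+α₀` carried by
the diagonal term). [cite: Hartman2002, Ch. IV §12 (12.12)] -/
def heunOp (N : ℕ) (p : HP) : CSeq →L[ℂ] CSeq := CSeq.mulCLM (p 0 • hcsD) + CSeq.recOp 3 (heunSym N p)

/-- `p ↦ heunOp N p` is smooth (affine). [folklore] -/
theorem contDiff_heunOp (N : ℕ) {n : WithTop ℕ∞} : ContDiff ℂ n fun p : HP ↦ heunOp N p := by
  unfold heunOp
  have hc : ∀ i : Fin 6, ContDiff ℂ n fun p : HP ↦ p i := fun i ↦ contDiff_apply ℂ ℂ i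
  refine ContDiff.add ?_ ?_
  · have hlin : ContDiff ℂ n fun d : CSeq ↦ CSeq.mulCLM d := (ContinuousLinearMap.mul ℂ CSeq).contDiff
    exact hlin.comp ((hc 0).smul contDiff_const)
  · refine (CSeq.contDiff_recOp 3).comp ?_
    refine contDiff_pi.2 fun j ↦ ?_
    fin_cases j
    · simp only [heunSym, Fin.zero_eta, Matrix.cons_val_zero]
      exact (contDiff_const.add ((hc 1).smul contDiff_const)).add ((hc 3).smul contDiff_const)
    · simp only [heunSym, Fin.mk_one, Matrix.cons_val_one, Matrix.cons_val_zero]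
      exact ((hc 2).smul contDiff_const).add ((hc 4).smul contDiff_const)
    · simp only [heunSym, Fin.reduceFinMk, Matrix.cons_val]
      exact (hc 5).smul contDiff_const

/-- Coordinates of the symbols. [folklore] -/
theorem heunSym_zero_apply (N : ℕ) (p : HP) (i : ℕ) :
    heunSym N p 0 i = (hsymA N i : ℂ) + p 1 * (hsymB N i : ℂ) + p 3 * (hsymC N i : ℂ) := rfl

/-- Coordinates of the symbols. [folklore] -/
theorem heunSym_one_apply (N : ℕ) (p : HP) (i : ℕ) :
    heunSym N p 1 i = p 2 * (hsymE N i : ℂ) + p 4 * (hsymF N i : ℂ) := rfl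

/-- Coordinates of the symbols. [folklore] -/
theorem heunSym_two_apply (N : ℕ) (p : HP) (i : ℕ) : heunSym N p 2 i = p 5 * (hsymG N i : ℂ) := rfl

/-- Coordinates of the operator at index `0`: `(T b)₀ = 0`. [folklore] -/
theorem heunOp_apply_zero (N : ℕ) (p : HP) (b : CSeq) : heunOp N p b 0 = 0 := by
  simp [heunOp, hcsD, hsymD]

/-- Coordinates of the operator at index `k+1`. [folklore] -/
theorem heunOp_apply_succ (N : ℕ) (p : HP) (b : CSeq) (k : ℕ) :
    heunOp N p b (k + 1) = p 0 * (hsymD (k + 1) : ℂ) * b (k + 1) +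
      ∑ j : Fin 3, if (j : ℕ) ≤ k then heunSym N p j (k + 1) * b (k - j) else 0 := by
  rw [heunOp, _root_.add_apply, BoundedContinuousFunction.add_apply, CSeq.recOp_apply_succ,
    CSeq.mulCLM_apply]
  rfl

/-- **The fixed point**: the rescaled coefficient sequence `bₖ 2^{−k}/(k+1)^N`. [cite: Hartman2002, Ch. IV §12 (12.12)] -/
def heunFix (N : ℕ) (p : HP) : CSeq := affineFix (heunOp N p) CSeq.unit

/-- The target of the identification: `gₖ = bₖ (1/2)ᵏ / Wₖ`. [folklore] -/
def heunResc (N : ℕ) (p : HP) (k : ℕ) : ℂ := heunCoeffP p k * (1 / 2) ^ k / (sphW N k : ℂ)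

/-- The fixed-point equation in coordinates, index `0`. [folklore] -/
theorem heunFix_apply_zero (N : ℕ) {p : HP} (hT : ‖heunOp N p‖ < 1) : heunFix N p 0 = 1 := by
  have h := congrArg (fun b : CSeq ↦ b 0) (affineFix_eq hT CSeq.unit)
  simp only [BoundedContinuousFunction.add_apply, heunOp_apply_zero, add_zero] at h
  rw [heunFix, h]
  rfl

/-- The fixed-point equation in coordinates, index `k+1`:
`(1 − α₀ D(k+1)) F(k+1) = Σⱼ dⱼ(k+1) F(k−j)`. [folklore] -/
theorem heunFix_apply_succ (N : ℕ) {p : HP} (hT : ‖heunOp N p‖ < 1) (k : ℕ) :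
    (1 - p 0 * (hsymD (k + 1) : ℂ)) * heunFix N p (k + 1) =
      ∑ j : Fin 3, if (j : ℕ) ≤ k then heunSym N p j (k + 1) * heunFix N p (k - j) else 0 := by
  have h := congrArg (fun b : CSeq ↦ b (k + 1)) (affineFix_eq hT CSeq.unit)
  simp only [BoundedContinuousFunction.add_apply, heunOp_apply_succ, CSeq.unit_apply_succ, zero_add] at h
  rw [heunFix]
  linear_combination h

variable {N : ℕ} {p : HP}

/-- `1 − α₀ D(k+1) = (k + 1 + α₀)/(k+1) ≠ 0` for `‖α₀‖ < 1`. [folklore] -/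
theorem one_sub_diag_ne_zero (hα : ‖p 0‖ < 1) (k : ℕ) : (1 : ℂ) - p 0 * (hsymD (k + 1) : ℂ) ≠ 0 := by
  have hk : (k : ℂ) + 1 ≠ 0 := by
    have : (0 : ℝ) < (k : ℝ) + 1 := by positivity
    exact_mod_cast this.ne'
  have h := natCast_add_one_add_ne_zero (p 0) hα k
  simp only [hsymD]
  push_cast
  intro h0
  apply h
  field_simp at h0
  linear_combination h0

/-- The rescaled recursion: step to index `1`. [folklore] -/
theorem heunResc_step_zero (hα : ‖p 0‖ < 1) :
    (1 - p 0 * (hsymD 1 : ℂ)) * heunResc N p 1 = heunSym N p 0 1 * heunResc N p 0 := by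
  have hrec := heunCoeff_rec_zero (p 1) (p 2) (p 3) (p 4) (p 5) (α₀ := p 0) hα
  have hW0 : (sphW N 0 : ℂ) ≠ 0 := by exact_mod_cast (sphW_pos N 0).ne'
  have hW1 : (sphW N 1 : ℂ) ≠ 0 := by exact_mod_cast (sphW_pos N 1).ne'
  have h0 : heunCoeffP p 0 = 1 := rfl
  have h0' : heunCoeff (p 0) (p 1) (p 2) (p 3) (p 4) (p 5) 0 = 1 := rfl
  simp only [h0'] at hrec
  simp only [heunResc, heunCoeffP, heunSym_zero_apply, hsymA, hsymB, hsymC, hsymD, h0', pow_zero, pow_one]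
  push_cast
  field_simp
  linear_combination hrec

/-- The rescaled recursion: step to index `2`. [folklore] -/
theorem heunResc_step_one (hα : ‖p 0‖ < 1) :
    (1 - p 0 * (hsymD 2 : ℂ)) * heunResc N p 2 =
      heunSym N p 0 2 * heunResc N p 1 + heunSym N p 1 2 * heunResc N p 0 := by
  have hrec := heunCoeff_rec_one (p 1) (p 2) (p 3) (p 4) (p 5) (α₀ := p 0) hα
  have hW0 : (sphW N 0 : ℂ) ≠ 0 := by exact_mod_cast (sphW_pos N 0).ne'
  have hW1 : (sphW N 1 : ℂ) ≠ 0 := by exact_mod_cast (sphW_pos N 1).ne'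
  have hW2 : (sphW N 2 : ℂ) ≠ 0 := by exact_mod_cast (sphW_pos N 2).ne'
  have h0' : heunCoeff (p 0) (p 1) (p 2) (p 3) (p 4) (p 5) 0 = 1 := rfl
  simp only [h0'] at hrec
  simp only [heunResc, heunCoeffP, heunSym_zero_apply, heunSym_one_apply, hsymA, hsymB, hsymC, hsymD, hsymE,
    hsymF, h0', pow_zero, pow_one]
  push_cast
  rw [show (0 : ℂ) + 2 = 2 by ring, show (1 : ℂ) + 1 = 2 by ring]
  field_simp
  linear_combination (4 : ℂ) * hrec

/-- The rescaled recursion: step to index `k + 3`. [folklore] -/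
theorem heunResc_step_add_two (hα : ‖p 0‖ < 1) (k : ℕ) :
    (1 - p 0 * (hsymD (k + 3) : ℂ)) * heunResc N p (k + 3) =
      heunSym N p 0 (k + 3) * heunResc N p (k + 2) + heunSym N p 1 (k + 3) * heunResc N p (k + 1) +
        heunSym N p 2 (k + 3) * heunResc N p k := by
  have hrec := heunCoeff_rec_add_two (p 1) (p 2) (p 3) (p 4) (p 5) (α₀ := p 0) hα k
  have hW0 : (sphW N k : ℂ) ≠ 0 := by exact_mod_cast (sphW_pos N k).ne'
  have hW1 : (sphW N (k + 1) : ℂ) ≠ 0 := by exact_mod_cast (sphW_pos N (k + 1)).ne'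
  have hW2 : (sphW N (k + 2) : ℂ) ≠ 0 := by exact_mod_cast (sphW_pos N (k + 2)).ne'
  have hW3 : (sphW N (k + 3) : ℂ) ≠ 0 := by exact_mod_cast (sphW_pos N (k + 3)).ne'
  have hk1 : (k : ℂ) + 3 ≠ 0 := by
    have : (0 : ℝ) < (k : ℝ) + 3 := by positivity
    exact_mod_cast this.ne'
  simp only [heunResc, heunCoeffP, heunSym_zero_apply, heunSym_one_apply, heunSym_two_apply, hsymA, hsymB, hsymC,
    hsymD, hsymE, hsymF, hsymG, show k + 2 + 1 = k + 3 from rfl]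
  push_cast
  rw [show (k : ℂ) + 2 + 1 = (k : ℂ) + 3 by ring, show (k : ℂ) + 1 + 2 = (k : ℂ) + 3 by ring]
  field_simp
  linear_combination (8 : ℂ) * (1 / 2 : ℂ) ^ k * hrec

/-- **Identification of the fixed point** with the rescaled coefficient sequence. [cite: Hartman2002, Ch. IV §12 (12.12)] -/
theorem heunFix_apply (hα : ‖p 0‖ < 1) (hT : ‖heunOp N p‖ < 1) (k : ℕ) : heunFix N p k = heunResc N p k := by
  induction k using Nat.strong_induction_on with
  | _ k ih =>
    match k with
    | 0 =>
      rw [heunFix_apply_zero N hT]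
      simp [heunResc, heunCoeffP, sphW]
    | 1 =>
      have e0 : heunFix N p 0 = heunResc N p 0 := ih 0 (by omega)
      have h := heunFix_apply_succ N hT 0
      rw [Fin.sum_univ_three] at h
      simp only [Fin.val_zero, Fin.val_one, Fin.val_two] at h
      rw [if_pos le_rfl, if_neg (by omega), if_neg (by omega), add_zero, add_zero, Nat.sub_zero, e0,
        ← heunResc_step_zero hα] at h
      exact mul_left_cancel₀ (one_sub_diag_ne_zero hα 0) h
    | 2 =>
      have e0 : heunFix N p 0 = heunResc N p 0 := ih 0 (by omega)
      have e1 : heunFix N p 1 = heunResc N p 1 := ih 1 (by omega)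
      have h := heunFix_apply_succ N hT 1
      rw [Fin.sum_univ_three] at h
      simp only [Fin.val_zero, Fin.val_one, Fin.val_two] at h
      rw [if_pos (by omega), if_pos le_rfl, if_neg (by omega), add_zero, Nat.sub_zero, Nat.sub_self, e0, e1,
        ← heunResc_step_one hα] at h
      exact mul_left_cancel₀ (one_sub_diag_ne_zero hα 1) h
    | k + 3 =>
      have e0 : heunFix N p k = heunResc N p k := ih k (by omega)
      have e1 : heunFix N p (k + 1) = heunResc N p (k + 1) := ih (k + 1) (by omega)
      have e2 : heunFix N p (k + 2) = heunResc N p (k + 2) := ih (k + 2) (by omega)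
      have h := heunFix_apply_succ N hT (k + 2)
      rw [Fin.sum_univ_three] at h
      simp only [Fin.val_zero, Fin.val_one, Fin.val_two] at h
      rw [if_pos (by omega), if_pos (by omega), if_pos (by omega), Nat.sub_zero,
        show k + 2 - 1 = k + 1 from rfl, show k + 2 - 2 = k from rfl, e0, e1, e2, ← heunResc_step_add_two hα k] at h
      exact mul_left_cancel₀ (one_sub_diag_ne_zero hα (k + 2)) h

/-! ### The contraction estimate -/

/-- The admissible parameter region: `‖α₀‖ ≤ 1/4` and `‖p‖ ≤ R`. [folklore] -/
def heunBall (R : ℝ) : Set HP := {p | ‖p 0‖ < 1 / 4 ∧ ‖p‖ < R}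

/-- The region is open. [folklore] -/
theorem isOpen_heunBall (R : ℝ) : IsOpen (heunBall R) :=
  (isOpen_lt (continuous_apply 0).norm continuous_const).inter (isOpen_lt continuous_norm continuous_const)

/-- **The contraction estimate**: `‖T(p)‖ ≤ 7/8` for `‖α₀‖ ≤ 1/4`, `‖p‖ ≤ R`, `N + 1 ≥ 13R`. [folklore] -/
theorem norm_heunOp_le (N : ℕ) {R : ℝ} (hR : 0 ≤ R) (hN : 13 * R ≤ (N : ℝ) + 1) {p : HP} (hα : ‖p 0‖ ≤ 1 / 4)
    (hp : ‖p‖ ≤ R) : ‖heunOp N p‖ ≤ 7 / 8 := by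
  have hpi : ∀ i, ‖p i‖ ≤ R := fun i ↦ (norm_le_pi_norm p i).trans hp
  have hN1 : (0 : ℝ) < (N : ℝ) + 1 := by positivity
  -- the diagonal term
  have hD : ‖CSeq.mulCLM (p 0 • hcsD)‖ ≤ 1 / 4 := by
    refine (CSeq.norm_mulCLM_le _).trans ?_
    rw [norm_smul]
    have h1 : ‖hcsD‖ ≤ 1 := CSeq.norm_mk_le zero_le_one _
    calc ‖p 0‖ * ‖hcsD‖ ≤ 1 / 4 * 1 := by gcongr
      _ = 1 / 4 := by norm_num
  -- the shift terms
  have hA : ‖hcsA N‖ ≤ 1 / 2 := CSeq.norm_mk_le (by norm_num) _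
  have hB : ‖hcsB N‖ ≤ 1 / (2 * ((N : ℝ) + 1)) := CSeq.norm_mk_le (by positivity) _
  have hC : ‖hcsC N‖ ≤ 1 / (2 * ((N : ℝ) + 1)) := CSeq.norm_mk_le (by positivity) _
  have hE : ‖hcsE N‖ ≤ 1 / (4 * ((N : ℝ) + 1)) := CSeq.norm_mk_le (by positivity) _
  have hF : ‖hcsF N‖ ≤ 1 / (4 * ((N : ℝ) + 1)) := CSeq.norm_mk_le (by positivity) _
  have hG : ‖hcsG N‖ ≤ 1 / (8 * ((N : ℝ) + 1)) := CSeq.norm_mk_le (by positivity) _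
  have h0 : ‖heunSym N p 0‖ ≤ 1 / 2 + R * (1 / (2 * ((N : ℝ) + 1))) + R * (1 / (2 * ((N : ℝ) + 1))) := by
    simp only [heunSym, Matrix.cons_val_zero]
    refine (norm_add_le _ _).trans (add_le_add ((norm_add_le _ _).trans (add_le_add hA ?_)) ?_)
    · rw [norm_smul]; exact mul_le_mul (hpi 1) hB (norm_nonneg _) hR
    · rw [norm_smul]; exact mul_le_mul (hpi 3) hC (norm_nonneg _) hR
  have h1 : ‖heunSym N p 1‖ ≤ R * (1 / (4 * ((N : ℝ) + 1))) + R * (1 / (4 * ((N : ℝ) + 1))) := by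
    simp only [heunSym, Matrix.cons_val_one, Matrix.cons_val_zero]
    refine (norm_add_le _ _).trans (add_le_add ?_ ?_)
    · rw [norm_smul]; exact mul_le_mul (hpi 2) hE (norm_nonneg _) hR
    · rw [norm_smul]; exact mul_le_mul (hpi 4) hF (norm_nonneg _) hR
  have h2 : ‖heunSym N p 2‖ ≤ R * (1 / (8 * ((N : ℝ) + 1))) := by
    simp only [heunSym, Matrix.cons_val]
    rw [norm_smul]; exact mul_le_mul (hpi 5) hG (norm_nonneg _) hR
  have hrec : ‖CSeq.recOp 3 (heunSym N p)‖ ≤ 1 / 2 + 13 / 8 * (R / ((N : ℝ) + 1)) := by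
    refine (CSeq.norm_recOp_le 3 _).trans ?_
    rw [Fin.sum_univ_three]
    have : ‖heunSym N p 0‖ + ‖heunSym N p 1‖ + ‖heunSym N p 2‖ ≤
        1 / 2 + R * (1 / (2 * ((N : ℝ) + 1))) + R * (1 / (2 * ((N : ℝ) + 1))) +
          (R * (1 / (4 * ((N : ℝ) + 1))) + R * (1 / (4 * ((N : ℝ) + 1)))) + R * (1 / (8 * ((N : ℝ) + 1))) := by
      linarith
    refine this.trans (le_of_eq ?_)
    field_simp
    ring
  have hfrac : R / ((N : ℝ) + 1) ≤ 1 / 13 := by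
    rw [div_le_div_iff₀ hN1 (by norm_num)]; linarith
  calc ‖heunOp N p‖ ≤ ‖CSeq.mulCLM (p 0 • hcsD)‖ + ‖CSeq.recOp 3 (heunSym N p)‖ := norm_add_le _ _
    _ ≤ 1 / 4 + (1 / 2 + 13 / 8 * (R / ((N : ℝ) + 1))) := add_le_add hD hrec
    _ ≤ 7 / 8 := by linarith

/-- An admissible exponent: `N(R) = ⌈13R⌉₊`. [folklore] -/
def heunN (R : ℝ) : ℕ := ⌈13 * R⌉₊

/-- `N(R)` is admissible. [folklore] -/
theorem le_heunN (R : ℝ) : 13 * R ≤ (heunN R : ℝ) + 1 := (Nat.le_ceil _).trans (le_add_of_nonneg_right zero_le_one)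

/-- **Smoothness of the fixed point in the parameters** on the region `heunBall R`. [folklore] -/
theorem contDiffOn_heunFix (R : ℝ) (hR : 0 ≤ R) {n : WithTop ℕ∞} :
    ContDiffOn ℂ n (fun p : HP ↦ heunFix (heunN R) p) (heunBall R) := by
  refine contDiffOn_affineFix (isOpen_heunBall R) (contDiff_heunOp _).contDiffOn contDiffOn_const ?_
  intro p hp
  exact (norm_heunOp_le _ hR (le_heunN R) (le_of_lt hp.1) (le_of_lt hp.2)).trans_lt (by norm_num)

/-- **Geometric bound on the coefficients**: for `‖α₀‖ ≤ 1/4`, `‖p‖ ≤ R`: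
`‖bₖ(p)‖ ≤ 8 (k+1)^{N(R)} 2ᵏ`. [cite: Hartman2002, Ch. IV §12 (12.12)] -/
theorem norm_heunCoeffP_le {R : ℝ} (hR : 0 ≤ R) {p : HP} (hα : ‖p 0‖ ≤ 1 / 4) (hp : ‖p‖ ≤ R) (k : ℕ) :
    ‖heunCoeffP p k‖ ≤ 8 * ((k : ℝ) + 1) ^ heunN R * 2 ^ k := by
  set N := heunN R with hN_def
  have hα1 : ‖p 0‖ < 1 := hα.trans_lt (by norm_num)
  have hT : ‖heunOp N p‖ ≤ 7 / 8 := norm_heunOp_le N hR (le_heunN R) hα hp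
  have hT1 : ‖heunOp N p‖ < 1 := hT.trans_lt (by norm_num)
  have hfix : ‖heunFix N p‖ ≤ 8 := by
    refine (norm_affineFix_le hT1 CSeq.unit).trans ?_
    have hu : ‖CSeq.unit‖ ≤ 1 := CSeq.norm_mk_le zero_le_one _
    rw [div_le_iff₀ (by linarith)]
    linarith
  have hk := (CSeq.norm_apply_le (heunFix N p) k).trans hfix
  rw [heunFix_apply hα1 hT1 k, heunResc] at hk
  rw [norm_div, norm_mul, Complex.norm_real, Real.norm_eq_abs, abs_of_pos (sphW_pos N k), norm_pow,
    div_le_iff₀ (sphW_pos N k)] at hk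
  rw [sphW] at hk
  have h12 : ‖(1 / 2 : ℂ)‖ = 1 / 2 := by norm_num
  rw [h12] at hk
  have hpow : (0 : ℝ) < (1 / 2 : ℝ) ^ k := by positivity
  calc ‖heunCoeffP p k‖ = ‖heunCoeffP p k‖ * (1 / 2) ^ k * 2 ^ k := by
        rw [mul_assoc, ← mul_pow]; norm_num
    _ ≤ 8 * ((k : ℝ) + 1) ^ N * 2 ^ k := by gcongr

end Engine

/-! ### The solution `ρ(ξ) = Σ bₖ ξᵏ` on `‖ξ‖ < 2/5`: convergence and the differential equation -/

section Solution

variable (p : HP)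

/-- **The analytic solution** `ρ(ξ; p) = Σₖ bₖ(p) ξᵏ` (junk `0` off the disc of convergence, which
has radius `≥ 1/2` for `‖α₀‖ ≤ 1/4`). [cite: Hartman2002, Ch. IV §12 (12.12)] -/
def heunFun (ξ : ℂ) : ℂ := ∑' k, heunCoeffP p k * ξ ^ k

/-- The coefficients rescaled to the evaluation radius `2/5`: `aₖ = bₖ (2/5)ᵏ`. [folklore] -/
def heunResc25 (k : ℕ) : ℂ := heunCoeffP p k * (2 / 5) ^ k

variable {p}

/-- `aₖ` is polynomially bounded when `‖α₀‖ ≤ 1/4`. [folklore] -/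
theorem polyBounded_heunResc25 (hα : ‖p 0‖ ≤ 1 / 4) : PolyBounded (heunResc25 p) := by
  refine ⟨8, heunN ‖p‖, fun k ↦ ?_⟩
  have h := norm_heunCoeffP_le (R := ‖p‖) (norm_nonneg p) hα le_rfl k
  rw [heunResc25, norm_mul, norm_pow]
  have h25 : ‖(2 / 5 : ℂ)‖ = 2 / 5 := by norm_num
  rw [h25]
  calc ‖heunCoeffP p k‖ * (2 / 5) ^ k ≤ 8 * ((k : ℝ) + 1) ^ heunN ‖p‖ * 2 ^ k * (2 / 5) ^ k := by gcongr
    _ = 8 * ((k : ℝ) + 1) ^ heunN ‖p‖ * (4 / 5) ^ k := by rw [mul_assoc, ← mul_pow]; norm_num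
    _ ≤ 8 * ((k : ℝ) + 1) ^ heunN ‖p‖ * 1 := by
        gcongr
        exact pow_le_one₀ (by norm_num) (by norm_num)
    _ = 8 * ((k : ℝ) + 1) ^ heunN ‖p‖ := mul_one _

/-- For `‖ξ‖ < 2/5` the rescaled point `(5/2) ξ` lies in the unit disc. [folklore] -/
theorem norm_rescale25_lt {ξ : ℂ} (hξ : ‖ξ‖ < 2 / 5) : ‖(5 / 2 : ℂ) * ξ‖ < 1 := by
  rw [norm_mul, show ‖(5 / 2 : ℂ)‖ = 5 / 2 by norm_num]
  linarith

/-- The series in the unit-disc variable `s = (5/2)ξ`. [folklore] -/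
def hser (a : ℕ → ℂ) (ξ : ℂ) : ℂ := cseries a ((5 / 2 : ℂ) * ξ)

/-- Its first `ξ`-derivative series. [folklore] -/
def hserD (a : ℕ → ℂ) (ξ : ℂ) : ℂ := 5 / 2 * cseries (dSeq a) ((5 / 2 : ℂ) * ξ)

/-- Its second `ξ`-derivative series. [folklore] -/
def hserD2 (a : ℕ → ℂ) (ξ : ℂ) : ℂ := (5 / 2) ^ 2 * cseries (dSeq (dSeq a)) ((5 / 2 : ℂ) * ξ)

/-- `d/dξ hser = hserD` on `‖ξ‖ < 2/5`. [folklore] -/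
theorem hasDerivAt_hser {a : ℕ → ℂ} (ha : PolyBounded a) {ξ : ℂ} (hξ : ‖ξ‖ < 2 / 5) :
    HasDerivAt (hser a) (hserD a ξ) ξ := by
  have h := hasDerivAt_cseries ha (norm_rescale25_lt hξ)
  have hlin : HasDerivAt (fun t : ℂ ↦ (5 / 2 : ℂ) * t) (5 / 2) ξ := by
    simpa using (hasDerivAt_id ξ).const_mul (5 / 2 : ℂ)
  have h2 : HasDerivAt (fun t : ℂ ↦ cseries a ((5 / 2 : ℂ) * t)) (cseries (dSeq a) ((5 / 2 : ℂ) * ξ) * (5 / 2)) ξ :=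
    h.comp ξ hlin
  rw [show hser a = fun t : ℂ ↦ cseries a ((5 / 2 : ℂ) * t) from rfl, hserD, mul_comm]
  exact h2

/-- `d/dξ hserD = hserD2` on `‖ξ‖ < 2/5`. [folklore] -/
theorem hasDerivAt_hserD {a : ℕ → ℂ} (ha : PolyBounded a) {ξ : ℂ} (hξ : ‖ξ‖ < 2 / 5) :
    HasDerivAt (hserD a) (hserD2 a ξ) ξ := by
  have h := hasDerivAt_cseries ha.dSeq (norm_rescale25_lt hξ)
  have hlin : HasDerivAt (fun t : ℂ ↦ (5 / 2 : ℂ) * t) (5 / 2) ξ := by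
    simpa using (hasDerivAt_id ξ).const_mul (5 / 2 : ℂ)
  have h2 : HasDerivAt (fun t : ℂ ↦ cseries (dSeq a) ((5 / 2 : ℂ) * t))
      (cseries (dSeq (dSeq a)) ((5 / 2 : ℂ) * ξ) * (5 / 2)) ξ := h.comp ξ hlin
  have h3 := h2.const_mul (5 / 2 : ℂ)
  rw [show hserD a = fun t : ℂ ↦ (5 / 2 : ℂ) * cseries (dSeq a) ((5 / 2 : ℂ) * t) from rfl]
  refine h3.congr_deriv ?_
  rw [hserD2]
  ring

/-- **The Heun operator on coefficients** (in the variable `s = (5/2)ξ`): the coefficient sequence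
of `ξ(ξ+1)ρ'' + (α₂ξ² + α₁ξ + 1 + α₀)ρ' + (β₂ξ² + β₁ξ + β₀)ρ` for `ρ = hser a`. [folklore] -/
def heunOdeCoeffOf (p : HP) (a : ℕ → ℂ) (k : ℕ) : ℂ :=
  shiftSeq (shiftSeq (dSeq (dSeq a))) k + 5 / 2 * shiftSeq (dSeq (dSeq a)) k +
    2 / 5 * p 2 * shiftSeq (shiftSeq (dSeq a)) k + p 1 * shiftSeq (dSeq a) k + 5 / 2 * (1 + p 0) * dSeq a k +
    4 / 25 * p 5 * shiftSeq (shiftSeq a) k + 2 / 5 * p 4 * shiftSeq a k + p 3 * a k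

/-- The operator preserves polynomial growth. [folklore] -/
theorem polyBounded_heunOdeCoeffOf {a : ℕ → ℂ} (ha : PolyBounded a) : PolyBounded (heunOdeCoeffOf p a) := by
  have hDa : PolyBounded (dSeq a) := ha.dSeq
  have hDDa : PolyBounded (dSeq (dSeq a)) := hDa.dSeq
  exact ((((((hDDa.shift.shift.add (hDDa.shift.const_mul _)).add (hDa.shift.shift.const_mul _)).add
    (hDa.shift.const_mul _)).add (hDa.const_mul _)).add (ha.shift.shift.const_mul _)).add
    (ha.shift.const_mul _)).add (ha.const_mul _)

/-- The operator on coefficients in terms of the recursion, index `k + 2` (with `aⱼ = bⱼ (2/5)ʲ`). [folklore] -/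
theorem heunOdeCoeffOf_resc (p : HP) (b : ℕ → ℂ) (k : ℕ) :
    heunOdeCoeffOf p (fun j ↦ b j * (2 / 5) ^ j) (k + 2) =
      (2 / 5 : ℂ) ^ (k + 2) *
        (((k : ℂ) + 3) * (((k : ℂ) + 2) + 1 + p 0) * b (k + 3) +
          (((k : ℂ) + 2) * ((k : ℂ) + 2 - 1) + p 1 * ((k : ℂ) + 2) + p 3) * b (k + 2) +
          (p 2 * ((k : ℂ) + 2 - 1) + p 4) * b (k + 1) + p 5 * b k) := by
  simp only [heunOdeCoeffOf, shiftSeq_succ, dSeq_apply]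
  push_cast
  ring

/-- The same at index `1`. [folklore] -/
theorem heunOdeCoeffOf_resc_one (p : HP) (b : ℕ → ℂ) :
    heunOdeCoeffOf p (fun j ↦ b j * (2 / 5) ^ j) 1 =
      (2 / 5 : ℂ) * ((2 : ℂ) * ((1 : ℂ) + 1 + p 0) * b 2 + ((1 : ℂ) * (1 - 1) + p 1 * 1 + p 3) * b 1 +
        (p 2 * (1 - 1) + p 4) * b 0) := by
  simp only [heunOdeCoeffOf, shiftSeq_zero, shiftSeq_succ, dSeq_apply]
  push_cast
  ring

/-- The same at index `0`. [folklore] -/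
theorem heunOdeCoeffOf_resc_zero (p : HP) (b : ℕ → ℂ) :
    heunOdeCoeffOf p (fun j ↦ b j * (2 / 5) ^ j) 0 =
      (1 : ℂ) * ((0 : ℂ) + 1 + p 0) * b 1 + ((0 : ℂ) * (0 - 1) + p 1 * 0 + p 3) * b 0 := by
  simp only [heunOdeCoeffOf, shiftSeq_zero, dSeq_apply]
  push_cast
  ring

/-- **The operator identity**: for polynomially bounded `a` and `‖ξ‖ < 2/5`,
`ξ(ξ+1) hserD2 + (α₂ξ² + α₁ξ + 1 + α₀) hserD + (β₂ξ² + β₁ξ + β₀) hser = hser (L a)`. [folklore] -/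
theorem hser_ode_identity {a : ℕ → ℂ} (ha : PolyBounded a) {ξ : ℂ} (hξ : ‖ξ‖ < 2 / 5) :
    ξ * (ξ + 1) * hserD2 a ξ + (p 2 * ξ ^ 2 + p 1 * ξ + 1 + p 0) * hserD a ξ +
        (p 5 * ξ ^ 2 + p 4 * ξ + p 3) * hser a ξ = hser (heunOdeCoeffOf p a) ξ := by
  set s : ℂ := (5 / 2 : ℂ) * ξ with hs_def
  have hs : ‖s‖ < 1 := norm_rescale25_lt hξ
  have hDa : PolyBounded (dSeq a) := ha.dSeq
  have hDDa : PolyBounded (dSeq (dSeq a)) := hDa.dSeq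
  have e1 : cseries (shiftSeq (dSeq (dSeq a))) s = s * cseries (dSeq (dSeq a)) s := cseries_shiftSeq hDDa hs
  have e2 : cseries (shiftSeq (shiftSeq (dSeq (dSeq a)))) s = s * (s * cseries (dSeq (dSeq a)) s) := by
    rw [cseries_shiftSeq hDDa.shift hs, e1]
  have e3 : cseries (shiftSeq (dSeq a)) s = s * cseries (dSeq a) s := cseries_shiftSeq hDa hs
  have e3' : cseries (shiftSeq (shiftSeq (dSeq a))) s = s * (s * cseries (dSeq a) s) := by
    rw [cseries_shiftSeq hDa.shift hs, e3]
  have e4 : cseries (shiftSeq a) s = s * cseries a s := cseries_shiftSeq ha hs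
  have e5 : cseries (shiftSeq (shiftSeq a)) s = s * (s * cseries a s) := by
    rw [cseries_shiftSeq ha.shift hs, e4]
  have hsum : cseries (heunOdeCoeffOf p a) s =
      cseries (shiftSeq (shiftSeq (dSeq (dSeq a)))) s + 5 / 2 * cseries (shiftSeq (dSeq (dSeq a))) s +
        2 / 5 * p 2 * cseries (shiftSeq (shiftSeq (dSeq a))) s + p 1 * cseries (shiftSeq (dSeq a)) s +
        5 / 2 * (1 + p 0) * cseries (dSeq a) s + 4 / 25 * p 5 * cseries (shiftSeq (shiftSeq a)) s +
        2 / 5 * p 4 * cseries (shiftSeq a) s + p 3 * cseries a s := by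
    have q1 : PolyBounded (fun k ↦ shiftSeq (shiftSeq (dSeq (dSeq a))) k) := hDDa.shift.shift
    have q2 : PolyBounded (fun k ↦ 5 / 2 * shiftSeq (dSeq (dSeq a)) k) := hDDa.shift.const_mul _
    have q3 : PolyBounded (fun k ↦ 2 / 5 * p 2 * shiftSeq (shiftSeq (dSeq a)) k) := hDa.shift.shift.const_mul _
    have q4 : PolyBounded (fun k ↦ p 1 * shiftSeq (dSeq a) k) := hDa.shift.const_mul _
    have q5 : PolyBounded (fun k ↦ 5 / 2 * (1 + p 0) * dSeq a k) := hDa.const_mul _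
    have q6 : PolyBounded (fun k ↦ 4 / 25 * p 5 * shiftSeq (shiftSeq a) k) := ha.shift.shift.const_mul _
    have q7 : PolyBounded (fun k ↦ 2 / 5 * p 4 * shiftSeq a k) := ha.shift.const_mul _
    have q8 : PolyBounded (fun k ↦ p 3 * a k) := ha.const_mul _
    have step : cseries (heunOdeCoeffOf p a) s =
        cseries (fun k ↦ shiftSeq (shiftSeq (dSeq (dSeq a))) k + 5 / 2 * shiftSeq (dSeq (dSeq a)) k +
          2 / 5 * p 2 * shiftSeq (shiftSeq (dSeq a)) k + p 1 * shiftSeq (dSeq a) k + 5 / 2 * (1 + p 0) * dSeq a k +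
          4 / 25 * p 5 * shiftSeq (shiftSeq a) k + 2 / 5 * p 4 * shiftSeq a k) s +
        cseries (fun k ↦ p 3 * a k) s := by
      rw [← cseries_add (((((((q1.add q2).add q3).add q4).add q5).add q6).add q7)) q8 hs]
      rfl
    rw [step, cseries_add ((((((q1.add q2).add q3).add q4).add q5).add q6)) q7 hs,
      cseries_add (((((q1.add q2).add q3).add q4).add q5)) q6 hs, cseries_add ((((q1.add q2).add q3).add q4)) q5 hs,
      cseries_add (((q1.add q2).add q3)) q4 hs, cseries_add ((q1.add q2)) q3 hs, cseries_add q1 q2 hs]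
    simp only [cseries_const_mul]
  have hξ' : ξ = 2 / 5 * s := by rw [hs_def]; ring
  rw [hser, hser, hserD, hserD2, ← hs_def, hsum, e1, e2, e3, e3', e4, e5, hξ']
  ring

/-- **The recursion kills the operator**: with `aₖ = bₖ(p) (2/5)ᵏ`, `L a = 0` (for `‖α₀‖ < 1`). [folklore] -/
theorem heunOdeCoeffOf_resc25 (hα : ‖p 0‖ < 1) (k : ℕ) : heunOdeCoeffOf p (heunResc25 p) k = 0 := by
  have hfun : heunResc25 p = fun j ↦ heunCoeffP p j * (2 / 5) ^ j := rfl
  rw [hfun]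
  match k with
  | 0 =>
    rw [heunOdeCoeffOf_resc_zero]
    have h := heunCoeff_rec_zero (p 1) (p 2) (p 3) (p 4) (p 5) (α₀ := p 0) hα
    simp only [heunCoeffP]
    linear_combination h
  | 1 =>
    rw [heunOdeCoeffOf_resc_one]
    have h := heunCoeff_rec_one (p 1) (p 2) (p 3) (p 4) (p 5) (α₀ := p 0) hα
    simp only [heunCoeffP]
    linear_combination (2 / 5 : ℂ) * h
  | k + 2 =>
    rw [heunOdeCoeffOf_resc]
    have h := heunCoeff_rec_add_two (p 1) (p 2) (p 3) (p 4) (p 5) (α₀ := p 0) hα k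
    simp only [heunCoeffP]
    linear_combination (2 / 5 : ℂ) ^ (k + 2) * h

/-- **The solution as a unit-disc series**: `ρ(ξ) = Σ aₖ ((5/2)ξ)ᵏ`. [folklore] -/
theorem heunFun_eq_hser (ξ : ℂ) : heunFun p ξ = hser (heunResc25 p) ξ := by
  rw [heunFun, hser, cseries]
  refine tsum_congr fun k ↦ ?_
  rw [heunResc25, mul_pow, mul_assoc, ← mul_assoc ((2 / 5 : ℂ) ^ k), ← mul_pow]
  norm_num

/-- **Convergence**: `HasSum (bₖ ξᵏ) (ρ(ξ))` for `‖ξ‖ < 2/5`, `‖α₀‖ ≤ 1/4`. [folklore] -/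
theorem hasSum_heunFun (hα : ‖p 0‖ ≤ 1 / 4) {ξ : ℂ} (hξ : ‖ξ‖ < 2 / 5) :
    HasSum (fun k ↦ heunCoeffP p k * ξ ^ k) (heunFun p ξ) := by
  have h := hasSum_cseries (polyBounded_heunResc25 hα) (norm_rescale25_lt hξ)
  rw [← hser, ← heunFun_eq_hser] at h
  refine h.congr_fun fun k ↦ ?_
  rw [heunResc25, mul_pow, mul_assoc, ← mul_assoc ((2 / 5 : ℂ) ^ k), ← mul_pow]
  norm_num

/-- `ρ(0) = 1`. [folklore] -/
theorem heunFun_zero : heunFun p 0 = 1 := by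
  rw [heunFun_eq_hser, hser, mul_zero, cseries_zero_right, heunResc25]
  simp [heunCoeffP]

variable (p)

/-- The first `ξ`-derivative of `ρ`. [folklore] -/
def heunDer (p : HP) (ξ : ℂ) : ℂ := hserD (heunResc25 p) ξ

/-- The second `ξ`-derivative of `ρ`. [folklore] -/
def heunDer2 (p : HP) (ξ : ℂ) : ℂ := hserD2 (heunResc25 p) ξ

variable {p}

/-- **`ρ' = heunDer`** on `‖ξ‖ < 2/5`. [folklore] -/
theorem hasDerivAt_heunFun (hα : ‖p 0‖ ≤ 1 / 4) {ξ : ℂ} (hξ : ‖ξ‖ < 2 / 5) :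
    HasDerivAt (heunFun p) (heunDer p ξ) ξ := by
  have h := hasDerivAt_hser (polyBounded_heunResc25 hα) hξ
  rw [show heunFun p = hser (heunResc25 p) from funext (heunFun_eq_hser (p := p))]
  exact h

/-- **`heunDer' = heunDer2`** on `‖ξ‖ < 2/5`. [folklore] -/
theorem hasDerivAt_heunDer (hα : ‖p 0‖ ≤ 1 / 4) {ξ : ℂ} (hξ : ‖ξ‖ < 2 / 5) :
    HasDerivAt (heunDer p) (heunDer2 p ξ) ξ :=
  hasDerivAt_hserD (polyBounded_heunResc25 hα) hξ

/-- `deriv ρ = heunDer`. [folklore] -/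
theorem deriv_heunFun (hα : ‖p 0‖ ≤ 1 / 4) {ξ : ℂ} (hξ : ‖ξ‖ < 2 / 5) : deriv (heunFun p) ξ = heunDer p ξ :=
  (hasDerivAt_heunFun hα hξ).deriv

/-- `deriv heunDer = heunDer2`. [folklore] -/
theorem deriv_heunDer (hα : ‖p 0‖ ≤ 1 / 4) {ξ : ℂ} (hξ : ‖ξ‖ < 2 / 5) : deriv (heunDer p) ξ = heunDer2 p ξ :=
  (hasDerivAt_heunDer hα hξ).deriv

/-- `ρ'(0) = b₁ = −β₀/(1 + α₀)`. [folklore] -/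
theorem heunDer_zero : heunDer p 0 = -p 3 / (1 + p 0) := by
  rw [heunDer, hserD, mul_zero, cseries_zero_right, dSeq_apply, heunResc25]
  simp [heunCoeffP, heunCoeff_one]
  ring

/-- **The differential equation**: for `‖α₀‖ ≤ 1/4` and `‖ξ‖ < 2/5`,
`ξ(ξ+1)ρ'' + (α₂ξ² + α₁ξ + 1 + α₀)ρ' + (β₂ξ² + β₁ξ + β₀)ρ = 0`. [cite: Hartman2002, Ch. IV §12 (12.12)] -/
theorem heunFun_ode (hα : ‖p 0‖ ≤ 1 / 4) {ξ : ℂ} (hξ : ‖ξ‖ < 2 / 5) :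
    ξ * (ξ + 1) * heunDer2 p ξ + (p 2 * ξ ^ 2 + p 1 * ξ + 1 + p 0) * heunDer p ξ +
      (p 5 * ξ ^ 2 + p 4 * ξ + p 3) * heunFun p ξ = 0 := by
  have hα1 : ‖p 0‖ < 1 := hα.trans_lt (by norm_num)
  rw [heunFun_eq_hser, heunDer, heunDer2, hser_ode_identity (p := p) (polyBounded_heunResc25 hα) hξ, hser]
  rw [cseries_congr (heunOdeCoeffOf_resc25 hα1), cseries]
  simp

end Solution

/-! ### Joint smoothness in `(ξ, p)` -/

section Smooth

/-- The bounded weight `wₖ = (k+1)^N (4/5)ᵏ` converting the fixed point `bₖ 2^{−k}/(k+1)^N` into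
the evaluation coefficients `bₖ (2/5)ᵏ`. [folklore] -/
def heunWeight (N : ℕ) : CSeq :=
  CSeq.mk (fun k ↦ ((((k : ℝ) + 1) ^ N * (4 / 5 : ℝ) ^ k : ℝ) : ℂ)) (∑' j : ℕ, ((j : ℝ) + 1) ^ N * (4 / 5 : ℝ) ^ j)
    fun k ↦ by
      rw [Complex.norm_real, Real.norm_eq_abs, abs_of_nonneg (by positivity)]
      exact (summable_succ_pow_mul_geometric N (by norm_num) (by norm_num)).le_tsum k
        fun j _ ↦ by positivity

/-- Coordinates of the weight. [folklore] -/
theorem heunWeight_apply (N k : ℕ) : heunWeight N k = ((((k : ℝ) + 1) ^ N * (4 / 5 : ℝ) ^ k : ℝ) : ℂ) := rfl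

/-- **The evaluation coefficient sequence** `p ↦ (bₖ(p) (2/5)ᵏ)ₖ ∈ ℕ →ᵇ ℂ`. [folklore] -/
def heunEvalSeq (N : ℕ) (p : HP) : CSeq := CSeq.mulCLM (heunWeight N) (heunFix N p)

/-- On the parameter region the evaluation sequence has coordinates `bₖ (2/5)ᵏ`. [folklore] -/
theorem heunEvalSeq_apply {R : ℝ} (hR : 0 ≤ R) {p : HP} (hα : ‖p 0‖ ≤ 1 / 4) (hp : ‖p‖ ≤ R) (k : ℕ) :
    heunEvalSeq (heunN R) p k = heunResc25 p k := by
  have hT1 : ‖heunOp (heunN R) p‖ < 1 := (norm_heunOp_le _ hR (le_heunN R) hα hp).trans_lt (by norm_num)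
  have hα1 : ‖p 0‖ < 1 := hα.trans_lt (by norm_num)
  rw [heunEvalSeq, CSeq.mulCLM_apply, heunFix_apply hα1 hT1 k, heunResc, heunWeight_apply, heunResc25]
  have hW : (sphW (heunN R) k : ℂ) ≠ 0 := by exact_mod_cast (sphW_pos _ k).ne'
  rw [sphW] at hW ⊢
  field_simp
  push_cast
  have h12 : ((1 : ℂ) / 2) ^ k * 2 ^ k = 1 := by rw [← mul_pow]; norm_num
  have h25 : ((4 : ℂ) / 5) ^ k = ((2 : ℂ) / 5) ^ k * 2 ^ k := by rw [← mul_pow]; norm_num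
  rw [h25]
  linear_combination (heunCoeffP p k * ((2 : ℂ) / 5) ^ k * (1 + (k : ℂ)) ^ heunN R) * h12

/-- `p ↦ heunEvalSeq N(R) p` is `C^∞` on the region. [folklore] -/
theorem contDiffOn_heunEvalSeq (R : ℝ) (hR : 0 ≤ R) {n : WithTop ℕ∞} :
    ContDiffOn ℂ n (fun p : HP ↦ heunEvalSeq (heunN R) p) (heunBall R) :=
  (CSeq.mulCLM (heunWeight (heunN R))).contDiff.comp_contDiffOn (contDiffOn_heunFix R hR)

/-- The open region `{‖ξ‖ < 2/5} × heunBall R`. [folklore] -/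
theorem isOpen_hregion (R : ℝ) : IsOpen {q : ℂ × HP | ‖q.1‖ < 2 / 5 ∧ q.2 ∈ heunBall R} :=
  (isOpen_lt continuous_fst.norm continuous_const).inter ((isOpen_heunBall R).preimage continuous_snd)

/-- **Joint holomorphy of the solution in the variable and the parameters**:
`(ξ, p) ↦ ρ(ξ; p)` is `C^∞` over `ℂ` on `{‖ξ‖ < 2/5} × {‖α₀‖ < 1/4, ‖p‖ < R}`. [cite: Hartman2002, Ch. IV §12] -/
theorem contDiffOn_heunFun (R : ℝ) {n : WithTop ℕ∞} (hn : n ≤ ∞) :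
    ContDiffOn ℂ n (fun q : ℂ × HP ↦ heunFun q.2 q.1) {q : ℂ × HP | ‖q.1‖ < 2 / 5 ∧ q.2 ∈ heunBall R} := by
  rcases lt_or_ge R 0 with hR | hR
  · intro q hq
    exact absurd (hq.2.2.trans hR) (not_lt.2 (norm_nonneg _))
  intro q hq
  have hO := isOpen_hregion R
  have hβ : ContDiffAt ℂ n (fun q : ℂ × HP ↦ heunEvalSeq (heunN R) q.2) q :=
    ((contDiffOn_heunEvalSeq R hR).contDiffAt ((isOpen_heunBall R).mem_nhds hq.2)).comp q contDiffAt_snd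
  have hξ : ContDiffAt ℂ n (fun q : ℂ × HP ↦ (5 / 2 : ℂ) * q.1) q := contDiffAt_const.mul contDiffAt_fst
  have h := contDiffAt_evCLM_apply hn 0 hβ hξ (norm_rescale25_lt hq.1)
  have heq : (fun q : ℂ × HP ↦ heunFun q.2 q.1) =ᶠ[𝓝 q]
      fun q : ℂ × HP ↦ evCLM 0 ((5 / 2 : ℂ) * q.1) (heunEvalSeq (heunN R) q.2) := by
    filter_upwards [hO.mem_nhds hq] with q' hq'
    rw [evCLM_zero_apply (norm_rescale25_lt hq'.1), heunFun_eq_hser, hser]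
    exact cseries_congr (fun k ↦ (heunEvalSeq_apply hR (le_of_lt hq'.2.1) (le_of_lt hq'.2.2) k).symm) _
  exact (h.congr_of_eventuallyEq heq).contDiffWithinAt

/-- **Joint holomorphy of the `ξ`-derivative** on the same region. [cite: Hartman2002, Ch. IV §12] -/
theorem contDiffOn_heunDer (R : ℝ) {n : WithTop ℕ∞} (hn : n ≤ ∞) :
    ContDiffOn ℂ n (fun q : ℂ × HP ↦ heunDer q.2 q.1) {q : ℂ × HP | ‖q.1‖ < 2 / 5 ∧ q.2 ∈ heunBall R} := by
  rcases lt_or_ge R 0 with hR | hR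
  · intro q hq
    exact absurd (hq.2.2.trans hR) (not_lt.2 (norm_nonneg _))
  intro q hq
  have hO := isOpen_hregion R
  have hβ : ContDiffAt ℂ n (fun q : ℂ × HP ↦ heunEvalSeq (heunN R) q.2) q :=
    ((contDiffOn_heunEvalSeq R hR).contDiffAt ((isOpen_heunBall R).mem_nhds hq.2)).comp q contDiffAt_snd
  have hξ : ContDiffAt ℂ n (fun q : ℂ × HP ↦ (5 / 2 : ℂ) * q.1) q := contDiffAt_const.mul contDiffAt_fst
  have h := (contDiffAt_evCLM_apply hn 1 hβ hξ (norm_rescale25_lt hq.1)).const_smul (5 / 2 : ℂ)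
  have heq : (fun q : ℂ × HP ↦ heunDer q.2 q.1) =ᶠ[𝓝 q]
      fun q : ℂ × HP ↦ (5 / 2 : ℂ) • evCLM 1 ((5 / 2 : ℂ) * q.1) (heunEvalSeq (heunN R) q.2) := by
    filter_upwards [hO.mem_nhds hq] with q' hq'
    rw [evCLM_one_apply (norm_rescale25_lt hq'.1), heunDer, hserD, smul_eq_mul]
    congr 1
    refine cseries_congr (fun k ↦ ?_) _
    rw [dSeq_apply, dSeq_apply, heunEvalSeq_apply hR (le_of_lt hq'.2.1) (le_of_lt hq'.2.2) (k + 1)]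
  exact (h.congr_of_eventuallyEq heq).contDiffWithinAt

/-- The admissible region is exhausted by the balls: any `p` with `‖α₀‖ < 1/4` lies in
`heunBall (‖p‖ + 1)`. [folklore] -/
theorem mem_heunBall_self {p : HP} (hα : ‖p 0‖ < 1 / 4) : p ∈ heunBall (‖p‖ + 1) := ⟨hα, by linarith⟩

/-- **Joint holomorphy at a point**: for `‖ξ₀‖ < 2/5` and `‖α₀‖ < 1/4`, `(ξ, p) ↦ ρ(ξ; p)` is
`C^∞` over `ℂ` at `(ξ₀, p₀)`. [cite: Hartman2002, Ch. IV §12] -/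
theorem contDiffAt_heunFun {ξ₀ : ℂ} (hξ₀ : ‖ξ₀‖ < 2 / 5) {p₀ : HP} (hα : ‖p₀ 0‖ < 1 / 4) {n : WithTop ℕ∞}
    (hn : n ≤ ∞) : ContDiffAt ℂ n (fun q : ℂ × HP ↦ heunFun q.2 q.1) (ξ₀, p₀) :=
  (contDiffOn_heunFun (‖p₀‖ + 1) hn).contDiffAt
    ((isOpen_hregion _).mem_nhds ⟨hξ₀, mem_heunBall_self hα⟩)

/-- See `contDiffAt_heunFun`, for the `ξ`-derivative. [cite: Hartman2002, Ch. IV §12] -/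
theorem contDiffAt_heunDer {ξ₀ : ℂ} (hξ₀ : ‖ξ₀‖ < 2 / 5) {p₀ : HP} (hα : ‖p₀ 0‖ < 1 / 4) {n : WithTop ℕ∞}
    (hn : n ≤ ∞) : ContDiffAt ℂ n (fun q : ℂ × HP ↦ heunDer q.2 q.1) (ξ₀, p₀) :=
  (contDiffOn_heunDer (‖p₀‖ + 1) hn).contDiffAt
    ((isOpen_hregion _).mem_nhds ⟨hξ₀, mem_heunBall_self hα⟩)

end Smooth

end Literature.Analysis.ODE

end
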